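import Literature.Probability.RandomPlanarGeometry.StarHullOneStepCompensated
import Literature.Probability.RandomPlanarGeometry.SchwarzianCapacity
import Literature.Probability.RandomPlanarGeometry.SLEBubblesSchwarzianMass
import Literature.Probability.RandomPlanarGeometry.SLERestrictionStepAlive
import Literature.Probability.RandomPlanarGeometry.RestrictionDerivTime
import HarnessLib

/-!
# Control of the slid hull along a whole short step ([LSW] Prop. 5.3: the compensator increment `∫ᵤ^{u+h} m`)

Deterministic complement to `StarHullOneStepMass` / `StarHullOneStepCompensated` for the martingale
`Y_t = h_t′(W_t)^α exp(−λ ∫₀ᵗ m(A_s − W_s) ds)` of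

* G. F. Lawler, O. Schramm, W. Werner, *Conformal restriction: the chordal case*, J. Amer. Math.
  Soc. **16** (2003) 917–955 (**[LSW]**), §5 Prop. 5.3 (with the Schwarzian mass `m = −SΦ/6`, (7.2)).

The compensated one-step expansion (`abs_compensatedStep_le`) consumes the integral
`J = ∫₀ʰ m(B_r) dr` of the mass over the step through `0 ≤ J ≤ h M_m` and
`|J − h m(B)| ≤ h · massStepC (h + η)`. This file supplies the pointwise facts behind these bounds:
for a `*`-hull `B` off `B(0, 16ρ₀)`, a continuous driver `U` from `0` with `|U| ≤ S` on `[0, h]` and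
`η = S + 4√h ≤ Φ_B′(0) ρ₀ / 1000`, at EVERY intermediate time `0 < r ≤ h`:

* the hulls have not reached `B`, the slid hull `B_r` is a `*`-hull off `B(0, 8ρ₀)` and
  `Φ′_{B_r}(0) ≥ Φ′_B(0)/2` (`subStep_control`; forward barrier `norm_map_sub_gt_of_im_pos` of
  `SLERestrictionStepAlive` for the flow started `16ρ₀` away, crude derivative bound
  `abs_starDeriv_sub_le_crude`);
* hence, when `2δ₀ ≤ Φ′_B(0)`, `0 ≤ m(B_r) ≤ massBound δ₀ ρ₀` and
  `|m(B_r) − m(B)| ≤ massStepC δ₀ ρ₀ (h + η)` (`subStep_mass_bounds`) — exactly the inputs of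
  `abs_compensatedStep_le` — the sign being [LSW] (5.1) (`starBubbleMass_nonneg_of_isStarHull`,
  `SchwarzianCapacity`) and the bound `starBubbleMass_le_of_control` (`abs_schwarzMass_le`).

## References

* [LSW] Prop. 5.3 (§5), (5.1), (7.2). [LawlerSchrammWerner2003Restriction]
* G. F. Lawler, *Conformally Invariant Processes in the Plane* (2005), Lemma 4.13, Rem. 4.9. [Lawler2005]
-/

noncomputable section

open Set Filter Metric Function
open _root_.Complex _root_.Topology
open UpperHalfPlane (upperHalfPlaneSet)
open scoped NNReal

namespace Literature.Probability.RandomPlanarGeometry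

namespace Loewner

/-! ### Sign and size of the mass of a `*`-hull -/

/-- **The mass of a `*`-hull is nonnegative** ([LSW] (5.1): `−SΦ_B(0)/6 = hcap ≥ 0`).
[cite: LawlerSchrammWerner2003Restriction, (5.1)] -/
theorem starBubbleMass_nonneg_of_isStarHull {B : Set ℂ} (hB : IsStarHull B) : 0 ≤ starBubbleMass B := by
  rcases B.eq_empty_or_nonempty with rfl | hne
  · rw [starBubbleMass_empty]
  · obtain ⟨hpos, hdisj⟩ := infDist_zero_pos hB hne
    exact (hasRestrictionJet_starRMap hB).bubbleMass_nonneg (starDeriv_spec hB).1 hpos hdisj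

/-- **The bound of the mass on the controlled class**: `m(B) ≤ massBound δ₀ ρ₀` for a `*`-hull `B`
off `B(0, 8ρ₀)` with `Φ_B′(0) ≥ δ₀` (`abs_schwarzMass_le`). [folklore] -/
theorem starBubbleMass_le_of_control {B : Set ℂ} (hB : IsStarHull B) {δ₀ ρ₀ : ℝ} (hδ0 : 0 < δ₀) (hρ₀ : 0 < ρ₀)
    (hδ : δ₀ ≤ starDeriv B) (hBρ : Disjoint (ball (0 : ℂ) (8 * ρ₀)) B) :
    starBubbleMass B ≤ massBound δ₀ ρ₀ := by
  obtain ⟨-, -, hc2, hc3, -⟩ := starJet_spec hB hρ₀ hBρ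
  rw [massBound]
  exact (le_abs_self _).trans (abs_schwarzMass_le hδ0 hρ₀ hδ hc2 hc3)


/-! ### Elementary facts on the step size -/

/-- `stepSize S ·` is monotone. [folklore] -/
theorem stepSize_mono (S : ℝ) {r h : ℝ≥0} (hrh : r ≤ h) : stepSize S r ≤ stepSize S h := by
  simp only [stepSize]
  have := Real.sqrt_le_sqrt (NNReal.coe_le_coe.2 hrh)
  linarith

/-- At time `0` nothing but the driver value is swallowed: the hulls have not reached a `*`-hull.
[folklore] -/
theorem disjoint_closedHull_zero_of_isStarHull {U : ℝ≥0 → ℝ} (hU : Continuous U) (hU0 : U 0 = 0) {B : Set ℂ}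
    (hB : IsStarHull B) : Disjoint (closedHull U 0) B := by
  rw [Set.disjoint_left]
  intro z hz hzB
  have hT : swallowingTime U z ≤ ((0 : ℝ≥0) : WithTop ℝ≥0) := hz.2
  have hz0 : z ≠ U 0 := by
    rw [hU0]; intro h
    exact hB.zero_notMem (by rw [Complex.ofReal_zero] at h; rwa [← h])
  have := swallowingTime_pos_holds hU hz0
  exact absurd (lt_of_lt_of_le this hT) (lt_irrefl _)

/-- At time `0` the slid hull is the hull (`U 0 = 0`). [folklore] -/
theorem slidHull_zero_of_eq_zero {U : ℝ≥0 → ℝ} (hU : Continuous U) (hU0 : U 0 = 0) {B : Set ℂ} (hB : IsStarHull B) :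
    slidHull U B 0 = B := by
  have h0 : ((U 0 : ℝ) : ℂ) ∉ B := by rw [hU0]; exact_mod_cast hB.zero_notMem
  rw [slidHull_zero hU h0, hU0]
  simp

/-! ### Control along the whole step -/

section SubStep

variable {B : Set ℂ} {ρ₀ : ℝ} {U : ℝ≥0 → ℝ} {h : ℝ≥0} {S : ℝ}
variable (hB : IsStarHull B) (hU : Continuous U) (hU0 : U 0 = 0)
  (hS : ∀ v : ℝ≥0, v ≤ h → |U v| ≤ S) (hρ₀ : 0 < ρ₀) (hBρ : Disjoint (ball (0 : ℂ) (16 * ρ₀)) B)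
  (hη : stepSize S h ≤ starDeriv B * ρ₀ / 1000)

include hρ₀ hBρ in
/-- `B(0, 8ρ₀)` is off `B` as well. [folklore] -/
theorem subStep_ball8 : Disjoint (ball (0 : ℂ) (8 * ρ₀)) B :=
  hBρ.mono_left (ball_subset_ball (by linarith))

include hB hS hρ₀ hη in
/-- Derived smallness: `η ≤ 2ρ₀` and `h ≤ (2ρ₀/4)²`. [folklore] -/
theorem subStep_smallness : stepSize S h ≤ 2 * ρ₀ ∧ (h : ℝ) ≤ (2 * ρ₀ / 4) ^ 2 := by
  obtain ⟨hd0, hd1, -⟩ := starDeriv_spec hB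
  have hS0 : 0 ≤ S := (abs_nonneg _).trans (hS 0 bot_le)
  have h1 : stepSize S h ≤ ρ₀ / 1000 := hη.trans (by
    rw [div_le_div_iff_of_pos_right (by norm_num)]; nlinarith)
  rw [stepSize] at h1
  have hs0 := Real.sqrt_nonneg (h : ℝ)
  have hsq : Real.sqrt h ≤ ρ₀ / 4000 := by linarith
  have hh' : (h : ℝ) = Real.sqrt h ^ 2 := (Real.sq_sqrt h.coe_nonneg).symm
  refine ⟨by rw [stepSize]; linarith, ?_⟩
  rw [hh']
  calc Real.sqrt h ^ 2 ≤ (ρ₀ / 4000) ^ 2 := pow_le_pow_left₀ hs0 hsq 2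
    _ ≤ (2 * ρ₀ / 4) ^ 2 := by
        apply pow_le_pow_left₀ (by positivity)
        rw [div_le_div_iff₀ (by norm_num) (by norm_num)]; nlinarith

include hB hU hU0 hS hρ₀ hBρ hη in
/-- **Control of the slid hull at every intermediate time of the step**: for `0 < r ≤ h` the hulls
have not reached `B`, `B_r = slidHull U B r` is a `*`-hull off `B(0, 8ρ₀)`, and
`Φ′_{B_r}(0) ≥ Φ′_B(0)/2` (forward barrier of the flow started `16ρ₀` away, and the crude one-step
derivative bound). [cite: Lawler2005, Lemma 4.13 and Rem. 4.9] -/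
theorem subStep_control {r : ℝ≥0} (hr0 : 0 < r) (hrh : r ≤ h) :
    Disjoint (closedHull U r) B ∧ IsStarHull (slidHull U B r) ∧
      Disjoint (ball (0 : ℂ) (8 * ρ₀)) (slidHull U B r) ∧ starDeriv B / 2 ≤ starDeriv (slidHull U B r) := by
  obtain ⟨hηρ, hh4⟩ := subStep_smallness hB hS hρ₀ hη
  obtain ⟨hd0, hd1, -⟩ := starDeriv_spec hB
  have hρ2 : 0 < 2 * ρ₀ := by positivity
  -- data for the survival lemmas with `W := U`, `A := B`, `u := 0`, radius `2ρ₀`, step `r`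
  have hu0 : Disjoint (closedHull U 0) B := disjoint_closedHull_zero_of_isStarHull hU hU0 hB
  have hB0 : slidHull U B 0 = B := slidHull_zero_of_eq_zero hU hU0 hB
  have hBρ0 : Disjoint (ball (0 : ℂ) (8 * (2 * ρ₀))) (slidHull U B 0) := by
    rw [hB0, show 8 * (2 * ρ₀) = 16 * ρ₀ by ring]; exact hBρ
  have hSr : ∀ v : ℝ≥0, v ≤ r → |U (0 + v) - U 0| ≤ S := fun v hv ↦ by
    rw [zero_add, hU0, sub_zero]; exact hS v (hv.trans hrh)
  have hηr : stepSize S r ≤ 2 * ρ₀ := (stepSize_mono S hrh).trans hηρ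
  have hr4 : (r : ℝ) ≤ (2 * ρ₀ / 4) ^ 2 := (NNReal.coe_le_coe.2 hrh).trans hh4
  have halive : Disjoint (closedHull U r) B := by
    have := disjoint_closedHull_add hU hB hu0 hρ2 hBρ0 hr0 hSr hηr hr4
    rwa [zero_add] at this
  have hstar : IsStarHull (slidHull U B r) := isStarHull_slidHull_of_disjoint hU hB halive
  -- the ball `B(0, 8ρ₀)` is off `B_r`
  have hball : Disjoint (ball (0 : ℂ) (8 * ρ₀)) (slidHull U B r) := by
    rw [Set.disjoint_left]
    rintro b hb hbB
    rw [mem_ball_zero_iff] at hb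
    obtain ⟨a, ha, rfl⟩ := mem_slidHull_iff.1 hbB
    have hcl : a ∈ closure (B ∩ upperHalfPlaneSet) := by rw [hB.isBoundedHull.2.1]; exact ha
    obtain ⟨w, hw, hwa⟩ := mem_closure_iff_seq_limit.1 hcl
    have haT : ((0 + r : ℝ≥0) : WithTop ℝ≥0) < swallowingTime U a :=
      forall_coe_add_lt_swallowingTime hU hB hu0 hρ2 hBρ0 hr0 hSr hηr hr4 a ha
    rw [zero_add] at haT
    have hcont : ContinuousAt (fun w ↦ ‖map U r w - U r‖) a :=
      ((continuousAt_map hU haT).sub continuousAt_const).norm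
    have hlim : Tendsto (fun k ↦ ‖map U r (w k) - U r‖) atTop (𝓝 ‖map U r a - U r‖) := hcont.tendsto.comp hwa
    have hge : 4 * (2 * ρ₀) ≤ ‖map U r a - U r‖ := ge_of_tendsto' hlim fun k ↦
      (norm_map_sub_gt_of_im_pos hU hB hu0 hρ2 hBρ0 hr0 hSr hηr hr4 (hw k).1 (hw k).2 bot_le
        (by rw [zero_add])).le
    linarith
  -- the derivative
  have hSr' : ∀ v : ℝ≥0, v ≤ r → |U v| ≤ S := fun v hv ↦ hS v (hv.trans hrh)
  have hηr' : stepSize S r ≤ starDeriv B * ρ₀ / 1000 := (stepSize_mono S hrh).trans hη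
  obtain ⟨hcrude, hsmall⟩ := abs_starDeriv_sub_le_crude hB hU hU0 hr0 hSr' hρ₀ (subStep_ball8 hρ₀ hBρ) hηr'
  have hder : starDeriv B / 2 ≤ starDeriv (slidHull U B r) := by
    have := (abs_le.1 (hcrude.trans hsmall)).1
    linarith
  exact ⟨halive, hstar, hball, hder⟩

include hB hU hU0 hS hρ₀ hBρ hη in
/-- **The mass along the step**: for `0 < r ≤ h`, with `2δ₀ ≤ Φ′_B(0)`,
`0 ≤ m(B_r) ≤ massBound δ₀ ρ₀` and `|m(B_r) − m(B)| ≤ massStepC δ₀ ρ₀ (h + η)` (the one-step estimate of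
`StarHullOneStepMass` at the sub-step `r`). [cite: LawlerSchrammWerner2003Restriction, Prop. 5.3 (the compensator increment)] -/
theorem subStep_mass_bounds {δ₀ : ℝ} (hδ0 : 0 < δ₀) (hδ : 2 * δ₀ ≤ starDeriv B) {r : ℝ≥0} (hr0 : 0 < r) (hrh : r ≤ h) :
    0 ≤ starBubbleMass (slidHull U B r) ∧ starBubbleMass (slidHull U B r) ≤ massBound δ₀ ρ₀ ∧
      |starBubbleMass (slidHull U B r) - starBubbleMass B| ≤ massStepC δ₀ ρ₀ * (h + stepSize S h) := by
  obtain ⟨-, hstar, hball, hder⟩ := subStep_control hB hU hU0 hS hρ₀ hBρ hη hr0 hrh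
  have hBρ8 := subStep_ball8 hρ₀ hBρ
  refine ⟨starBubbleMass_nonneg_of_isStarHull hstar, ?_, ?_⟩
  · exact starBubbleMass_le_of_control hstar hδ0 hρ₀ (by linarith) hball
  · have hSr' : ∀ v : ℝ≥0, v ≤ r → |U v| ≤ S := fun v hv ↦ hS v (hv.trans hrh)
    have hηr : stepSize S r ≤ starDeriv B * ρ₀ / 1000 := (stepSize_mono S hrh).trans hη
    have key := abs_schwarzMass_slidHull_sub_le hB hU hU0 hr0 hSr' hρ₀ hBρ8 hηr hδ0 (by linarith : δ₀ ≤ starDeriv B)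
    refine (show |starBubbleMass (slidHull U B r) - starBubbleMass B| ≤
      massStepC δ₀ ρ₀ * (r + stepSize S r) from key).trans ?_
    exact mul_le_mul_of_nonneg_left (add_le_add (NNReal.coe_le_coe.2 hrh) (stepSize_mono S hrh))
      (massStepC_nonneg hδ0 hρ₀)

end SubStep

end Loewner

end Literature.Probability.RandomPlanarGeometry

end
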